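import Summits.Ventures.CertifiedQuantumChemistry.Certificates.HubbardRingL4LiftPairQPSD
import HarnessLib

/-!
# Ventures/CertifiedQuantumChemistry — Certificates/HubbardRingL4LiftCoeffRows.lean: the COEFFICIENTWISE LINEAR FACTS of the
# L = 4 lift family (kernel): Hermiticity / spin selection / traces / contraction / antisymmetries of every coefficient
# `(γ_jk, Γ_jk)`, the `Q`-coefficients as the pair-valued `Q`-map of `(γ_jk, Γ_jk)`, and the objective's bond / doublon sums

HONEST FRAMING (verbatim): certified bounds for a stated model Hamiltonian in a stated basis; not a
claim about the real molecule beyond that model. Auxiliary objects only; no model energy is bounded here.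

Seat rdm-B (gen 41; layer 2, part (a), of the lift assembly — see `tools/x14-g41/NOTES-session.md`). Every statement is a
finite identity of rational pairs decided by the kernel; the successor's assembly file turns them, by linearity in
`(ε, δ)`, into the rows of `IsDQGFeasibleSector 2 2 (γ(U,δ)) (Γ(U,δ))` and into `U·Re E = −8 − 4√2 + 4δ`.
-/

set_option linter.style.longLine false

namespace Summit.Ventures.CertifiedQuantumChemistry

namespace LiftL4

open Matrix Finset PencilBlock SqrtTwo BlockScatter DQGGap
open Literature.MathematicalPhysics.QuantumLattice

/-! ## §1 Pair-valued maps -/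

/-- A 4-index pair table read as a function on spin orbitals. -/
def gamP (g : Fin 4 → Fin 2 → Fin 4 → Fin 2 → ℚ × ℚ) (x y : Orb (Fin 4)) : ℚ × ℚ :=
  g (ofLex x).1 (ofLex x).2 (ofLex y).1 (ofLex y).2

/-- The family of one-matrix coefficient tables `γ_jk` (`γ_{01} = γ_{11} = 0`). -/
def liftGam : Fin 3 → Fin 2 → Fin 4 → Fin 2 → Fin 4 → Fin 2 → ℚ × ℚ :=
  ![![liftGam00, fun _ _ _ _ => 0], ![liftGam10, fun _ _ _ _ => 0], ![liftGam20, liftGam21]]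

/-- Mazziotti's `Q`-map on PAIR-valued data, with the constant term switched by `c` (the map is affine; along the family
the constant belongs to the coefficient `(0,0)` only). Same formula as `DQGGap.qMapQ`. -/
def qMapP (c : Bool) (γ : Orb (Fin 4) → Orb (Fin 4) → ℚ × ℚ)
    (Γ : Orb (Fin 4) × Orb (Fin 4) → Orb (Fin 4) × Orb (Fin 4) → ℚ × ℚ) (p q : Orb (Fin 4) × Orb (Fin 4)) : ℚ × ℚ :=
  (if c then ((if p.1 = q.1 ∧ p.2 = q.2 then ((1, 0) : ℚ × ℚ) else 0) - (if p.1 = q.2 ∧ p.2 = q.1 then ((1, 0) : ℚ × ℚ) else 0))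
    else 0) -
    (if p.2 = q.2 then γ q.1 p.1 else 0) + (if p.2 = q.1 then γ q.2 p.1 else 0) +
    (if p.1 = q.2 then γ q.1 p.2 else 0) - (if p.1 = q.1 then γ q.2 p.2 else 0) + Γ q p

/-- The `G`-map on PAIR-valued data (linear). Same formula as `DQGGap.gMapQ`. -/
def gMapP (γ : Orb (Fin 4) → Orb (Fin 4) → ℚ × ℚ) (Γ : Orb (Fin 4) × Orb (Fin 4) → Orb (Fin 4) × Orb (Fin 4) → ℚ × ℚ)
    (p q : Orb (Fin 4) × Orb (Fin 4)) : ℚ × ℚ :=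
  (if p.2 = q.2 then γ p.1 q.1 else 0) - Γ (p.1, q.2) (q.1, p.2)

/-! ## §2 The `Q`-coefficients are the `Q`-map of the coefficients (kernel) -/

/-- `Q_{00} = qMapP [00 = 00] (γ_{00}, Γ_{00})` (kernel evaluation; one coefficient per `decide`). -/
theorem liftQQ_eq_qMapP00 : ∀ (I J : Fin (4 * 2 * (4 * 2))),
    toFinP (GamP (liftQQ 0 0)) I J = toFinP (qMapP true (gamP (liftGam 0 0)) (GamP (liftGG 0 0))) I J := by
  decide +kernel

/-- `Q_{01} = qMapP [01 = 00] (γ_{01}, Γ_{01})` (kernel evaluation; one coefficient per `decide`). -/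
theorem liftQQ_eq_qMapP01 : ∀ (I J : Fin (4 * 2 * (4 * 2))),
    toFinP (GamP (liftQQ 0 1)) I J = toFinP (qMapP false (gamP (liftGam 0 1)) (GamP (liftGG 0 1))) I J := by
  decide +kernel

/-- `Q_{10} = qMapP [10 = 00] (γ_{10}, Γ_{10})` (kernel evaluation; one coefficient per `decide`). -/
theorem liftQQ_eq_qMapP10 : ∀ (I J : Fin (4 * 2 * (4 * 2))),
    toFinP (GamP (liftQQ 1 0)) I J = toFinP (qMapP false (gamP (liftGam 1 0)) (GamP (liftGG 1 0))) I J := by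
  decide +kernel

/-- `Q_{11} = qMapP [11 = 00] (γ_{11}, Γ_{11})` (kernel evaluation; one coefficient per `decide`). -/
theorem liftQQ_eq_qMapP11 : ∀ (I J : Fin (4 * 2 * (4 * 2))),
    toFinP (GamP (liftQQ 1 1)) I J = toFinP (qMapP false (gamP (liftGam 1 1)) (GamP (liftGG 1 1))) I J := by
  decide +kernel

/-- `Q_{20} = qMapP [20 = 00] (γ_{20}, Γ_{20})` (kernel evaluation; one coefficient per `decide`). -/
theorem liftQQ_eq_qMapP20 : ∀ (I J : Fin (4 * 2 * (4 * 2))),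
    toFinP (GamP (liftQQ 2 0)) I J = toFinP (qMapP false (gamP (liftGam 2 0)) (GamP (liftGG 2 0))) I J := by
  decide +kernel

/-- `Q_{21} = qMapP [21 = 00] (γ_{21}, Γ_{21})` (kernel evaluation; one coefficient per `decide`). -/
theorem liftQQ_eq_qMapP21 : ∀ (I J : Fin (4 * 2 * (4 * 2))),
    toFinP (GamP (liftQQ 2 1)) I J = toFinP (qMapP false (gamP (liftGam 2 1)) (GamP (liftGG 2 1))) I J := by
  decide +kernel

/-- `Q_jk = qMapP [jk = 00] (γ_jk, Γ_jk)` for all four coefficients (assembled). -/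
theorem liftQQ_eq_qMapP : ∀ (j : Fin 3) (k : Fin 2) (I J : Fin (4 * 2 * (4 * 2))),
    toFinP (GamP (liftQQ j k)) I J =
      toFinP (qMapP (decide ((j : ℕ) = 0 ∧ (k : ℕ) = 0)) (gamP (liftGam j k)) (GamP (liftGG j k))) I J := by
  intro j k
  fin_cases j <;> fin_cases k
  exacts [liftQQ_eq_qMapP00, liftQQ_eq_qMapP01, liftQQ_eq_qMapP10, liftQQ_eq_qMapP11, liftQQ_eq_qMapP20,
    liftQQ_eq_qMapP21]

/-! ## §3 The linear rows of `IsDQGFeasibleSector 2 2`, coefficientwise (kernel) -/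

/-- One-matrix rows per coefficient: symmetry, `S_z` selection; spin traces `(2, 2)` at `(0,0)` and `0` otherwise. -/
theorem liftGam_rows : ∀ (j : Fin 3) (k : Fin 2),
    (∀ p σ q τ, liftGam j k p σ q τ = liftGam j k q τ p σ) ∧ (∀ p q σ τ, σ ≠ τ → liftGam j k p σ q τ = 0) ∧
      (∑ x : Fin 4, liftGam j k x 0 x 0 = if (j : ℕ) = 0 ∧ (k : ℕ) = 0 then ((2, 0) : ℚ × ℚ) else 0) ∧
      (∑ x : Fin 4, liftGam j k x 1 x 1 = if (j : ℕ) = 0 ∧ (k : ℕ) = 0 then ((2, 0) : ℚ × ℚ) else 0) := by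
  decide +kernel

/-- Two-matrix rows per coefficient: contraction onto `3·γ_jk`, antisymmetry in each pair, sector block traces
`(2, 2, 4)·[jk = 00]`. -/
theorem liftGG_rows : ∀ (j : Fin 3) (k : Fin 2),
    (∀ p σ q τ, ∑ r : Fin 4, ∑ μ : Fin 2, liftGG j k p σ r μ q τ r μ = ((3, 3) : ℚ × ℚ) * liftGam j k p σ q τ) ∧
      (∀ p σ q τ r μ s ν, liftGG j k q τ p σ r μ s ν = -liftGG j k p σ q τ r μ s ν) ∧
      (∀ p σ q τ r μ s ν, liftGG j k p σ q τ s ν r μ = -liftGG j k p σ q τ r μ s ν) ∧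
      (∑ x : Fin 4, ∑ y : Fin 4, liftGG j k x 0 y 0 x 0 y 0 = if (j : ℕ) = 0 ∧ (k : ℕ) = 0 then ((2, 0) : ℚ × ℚ) else 0) ∧
      (∑ x : Fin 4, ∑ y : Fin 4, liftGG j k x 1 y 1 x 1 y 1 = if (j : ℕ) = 0 ∧ (k : ℕ) = 0 then ((2, 0) : ℚ × ℚ) else 0) ∧
      (∑ x : Fin 4, ∑ y : Fin 4, liftGG j k x 0 y 1 x 0 y 1 = if (j : ℕ) = 0 ∧ (k : ℕ) = 0 then ((4, 0) : ℚ × ℚ) else 0) := by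
  decide +kernel

/-! ## §4 The objective along the family (kernel) -/

/-- Bond sums `Σ_{p,σ} γ_jk(pσ;(p+1)σ)` and doublon sums `Σ_p Γ_jk(p↑,p↓;p↑,p↓)` of the four coefficients:
`B_{10} = 8 + 4√2`, `D_{20} = 8 + 4√2`, `D_{21} = 4`, all others `0` — so that along the family, with `ε = 1/U`,
`U·Re E = −2·(8 + 4√2) + (8 + 4√2) + 4δ = −8 − 4√2 + 4δ`. -/
theorem lift_objective_sums :
    (∀ (j : Fin 3) (k : Fin 2), ∑ p : Fin 4, ∑ σ : Fin 2, liftGam j k p σ (finRotate 4 p) σ =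
        if (j : ℕ) = 1 ∧ (k : ℕ) = 0 then ((8, 4) : ℚ × ℚ) else 0) ∧
      (∀ (j : Fin 3) (k : Fin 2), ∑ p : Fin 4, liftGG j k p 0 p 1 p 0 p 1 =
        if (j : ℕ) = 2 ∧ (k : ℕ) = 0 then ((8, 4) : ℚ × ℚ) else if (j : ℕ) = 2 ∧ (k : ℕ) = 1 then ((4, 0) : ℚ × ℚ) else 0) := by
  constructor <;> decide +kernel

end LiftL4

end Summit.Ventures.CertifiedQuantumChemistry
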